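import Mathlib
import HarnessLib
import Summits.CriticalPhenomena.CardyFormulaZ2.Theses.CardySelfRefinement
import Summits.CriticalPhenomena.CardyFormulaZ2.Theorems.CardySelfRefinementSymmetryUpgradeRReversible
import Summits.CriticalPhenomena.CardyFormulaZ2.Theorems.CardySelfRefinementSymmetryUpgradeRReflectionCovariant
import Summits.CriticalPhenomena.CardyFormulaZ2.Theorems.CardySelfRefinementSymmetryUpgradeRCardyPinsSLE6
import Summits.CriticalPhenomena.CardyFormulaZ2.Theorems.CardySelfRefinementSymmetryUpgradeRTouchOfIkhlefPonsaing
import Literature.Probability.Percolation.IkhlefPonsaingFirstPassage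
import Literature.Probability.RandomPlanarGeometry.ChordalReversibility
import Literature.Probability.RandomPlanarGeometry.ConformalRectangle
import Literature.Probability.RandomPlanarGeometry.IsometryCovariance

/-!
# Line skeleton `SketchIdeatorTwo` (idea `swallowing-skeleton-rs-pin`) for crux `SymmetryUpgradeR`
# (stmt-CriticalPhenomena-17239, route CardySelfRefinement) — revision 4 (after wave 3)

Lead-owned skeleton (prover-line-stmt-CriticalPhenomena-17239-0, 2026-08-17), built from the crux-ideate sketch
`Cruxes/SymmetryUpgradeR/SketchIdeatorTwo.lean` (`LineShape`). Sorries ONLY inside the open `stub_*`;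
`SymmetryUpgradeR_of` is sorry-free glue concluding the crux BY NAME.

Revision 4 (wave 3 integrated): S3 `stub_touchExponent` is no longer a stub — it is the THEOREM `touchExponent` below,
CLOSED MODULO the tree's named unproved Literature fact `Literature.Probability.Percolation.IkhlefPonsaingFirstPassage`
(Ikhlef–Ponsaing 2012 Prop. 4.7): landed `touchExponent_of_ikhlefPonsaing` (p140621) assembling the wave-3 lattice work
(L1 separation dictionary `touchExponent_sepDictionary` p140400 + p140194/p140170/p140052; L2 wired arm
`touchExponent_wiredArmLower` p140501 + p139464/p139504; assembly p137778; upper bound p137540; portmanteau p134318).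
The pin composition `SymmetryUpgradeR_of_pin` therefore rests on S1, S4, S5a and the named fact itself, registered
verbatim as the stub S3′ `stub_ikhlefPonsaing` (so that every unproved input is a registered obligation); the primary
composition `SymmetryUpgradeR_of` (S1 + S7) is unchanged. S7 is also reduced (p140496,
`pinnedSchrammLSW_of_typedSchrammLSW`) to the predecessor crux's open `stub_typedSchrammLSW` (stmt-CriticalPhenomena-0698).
Open stubs: S1 `stub_conformalFront` (= conformal covariance of the pinned bond-ℤ² family: the open problem), S7, S4, S5a.

State after wave 1 (all landed files under `Summits/CriticalPhenomena/CardyFormulaZ2/Theorems/CardySelfRefinementSymmetryUpgradeR*.lean`):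

* S1 `stub_conformalFront` — OPEN (the front end: similarity-covariant local Markov + non-tracing + clause (iv) ⇒
  conformal covariance; "Euclidean + scale + Markov + locality ⇒ conformal" for the percolation limit; lead).
* S2 `stub_reversible` — CLOSED, p134454 (`…Reversible.lean`): reversibility of the limit family is FORCED by clause
  (iv) + locality (orientation-reversed Dobrushin structure carries the same admissible families; endpoint rule).
* S3 `stub_touchExponent` — RESHAPED twice; since revision 4 CLOSED MODULO `IkhlefPonsaingFirstPassage` (p140621, theorem
  `touchExponent` below): exact boundary-touch exponent `1/3` of the limit family at SOME
  locally FLAT boundary point of the second arc of some Dobrushin domain (two-sided constants). Revision history: the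
  card's all-domains form is false at boundary corners (opening angle `θ` ⇒ exponent `π/(3θ)`); the unit-disc form
  (rev. 1) is out of reach even modulo the named facts (curved wall: rotation transfer exists only in log form,
  wave-1 verdict); the flat-wall ∃-form lets the prover choose a DIAGONAL wall, where Ikhlef–Ponsaing Prop. 4.7
  (tree fact `Literature.Probability.Percolation.IkhlefPonsaingFirstPassage`, unproved, being formalised) + RSW
  (`HalfPlaneOneArmQuasiMultiplicativity`, the CardyBoundaryCoulombGas `HalfPlaneOneArmThird` line) give two-sided
  `n^{-1/3}` lattice asymptotics, and the landed portmanteau reduction `stub_touchExponent_ofLatticeBounds` (p134318)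
  passes them to `P`.
* S4 `stub_exitRigidity` — OPEN (the pin, NEW mathematics; lattice-free): conformal covariance + achirality +
  reversibility + typed local Markov bundle + touch exponent `1/3` at a flat boundary point ⇒ Cardy's hitting
  function on conformal rectangles. Landed first rung: the exit function EXISTS (`exitRigidity_exitFunction` p134418,
  `exitRigidity_imageDataOfModulus` p135034, `exitRigidity_exitFunctionOfModulus(_isometry)` p135186: `h_P(R)` is a
  function of the cross-ratio per orientation class, of the cross-ratio alone under `IsIsometryCovariant`).
* S5 — SPLIT: the registered S5 statement (Cardy on rectangles + … ⇒ SLE₆) is now the THEOREM `cardyPinsSLE6` below,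
  from the open middle S5a `stub_middleDrivingMartingale` (Schramm's principle for the clause-(iv) family: a driving
  process `√6 ×` continuous local martingale with quadratic variation `t` in one uniformized domain) and the landed
  `cardyPinsSLE6_of_drivingMartingale` (p134399; Lévy + `isSLELaw_of_isLocalMartingale_driving_through` + one-domain
  reduction). Also landed: `cardyPinsSLE6_of_sleFamily` (Cardy pins `κ = 6` among SLE families).
* S6 `stub_reflectionCovariant` — CLOSED, p135156 (`…ReflectionCovariant.lean`, helpers p134804 `…ReflectionLattice`,
  p135022 `…ReflectionInterface`): the limit family is isometry covariant (exact lattice reflection symmetry: the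
  exploration of the reflected data is the reflected path reversed; passed to the limit).
* Glue landed: `symmetryUpgradeR_iff_cardyRotToConfR2SymmetryUpgradeR` (p133665): this crux ↔ stmt-CriticalPhenomena-17237.

* S7 `stub_pinnedSchrammLSW` (revision 3, PRIMARY back end) — typed Schramm–LSW for the PINNED family: a conformally
  covariant, achiral, reversible local Markov chordal family that a.s. traces no boundary arc and satisfies clause (iv)
  is chordal SLE₆ in every Dobrushin domain (= the predecessor crux's open `stub_typedSchrammLSW` weakened by clause
  (iv) + S2 + S6; `κ = 6` is pinned by target independence alone, landed `stub_localityPinsSix`). WHY PRIMARY (wave-2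
  structural finding, evidence `stub_exitRigidity_partial.lean` (E0)–(E4)): the typed axioms yield NO closed
  renewal-consistency equation in the exit function `F_P` alone (arc-landing renewal involves the law of the random
  post-landing modulus), and the `F`-only consequences (symmetry `F(η)+F(1−η)=1`, two-sided `η^{1/3}` asymptotics) do
  not pin Cardy (`F_Cardy + δ sin(2πη) η(1−η)`); so S4 is either route (A) = typed Schramm principle (landed
  `exitRigidity_of_typedSchrammPrinciple`, p136876 — and then S2/S3/S6 are unused) or an unformulated classification.
  The honest open core of the line is therefore S1 (front end) + S7 (typed Schramm–LSW, pinned) — BOTH crux-sized.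

Compositions: PRIMARY `SymmetryUpgradeR_of` ⇐ S1 + S7 (+ landed S2, S6); ALTERNATIVE (the card's pin route, kept
registered for the disprover and for off-path landings) `SymmetryUpgradeR_of_pin` ⇐ S1 + S3 + S4 + S5a (+ landed glue).
-/

noncomputable section

namespace Summit.CriticalPhenomena.CardyFormulaZ2.Cruxes.SymmetryUpgradeR.SwallowingSkeleton

open MeasureTheory Filter Set
open Literature.Probability.RandomPlanarGeometry Literature.Probability.LatticeModels
open Literature.Probability.Percolation hiding cardyFunction
open UpperHalfPlane (upperHalfPlaneSet)

/-- Clause (ii) of `SymmetryUpgradeR`: `P D`-a.s. the curve traces no boundary arc. -/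
def NonTracing (P : ChordalFamily) : Prop :=
  (∀ D : DobrushinDomain, ∀ᵐ γ ∂(P D), ∀ c : Curve ℂ, CurveClass.mk c = γ →
        ∀ s t : unitInterval, s < t → c '' Set.Icc s t ⊆ frontier D.carrier →
          (c '' Set.Icc s t).Subsingleton)

/-- Clauses (iii)+(iv) of `SymmetryUpgradeR`: interfaces eventually a.e.-measurable, and `P D` is the sequential
scaling limit of the bond-ℤ² (`p = ½`) exploration interfaces along ONE mesh sequence, for every Dobrushin domain
and every admissible ℤ²-discretisation family. -/
def ClauseIV (P : ChordalFamily) : Prop :=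
  ((∀ (D : DobrushinDomain) (E : ℝ → DiscreteDobrushin), ZdDiscretisationFamily D E →
          ∀ᶠ δ in nhdsWithin (0 : ℝ) (Set.Ioi 0),
            AEMeasurable (bondInterfaceIn D (E δ)) (bondPercolation (zdGraph 2) half)) ∧
        ∃ δs : ℕ → ℝ, (∀ n, 0 < δs n) ∧ Tendsto δs atTop (nhds 0) ∧
          ∀ (D : DobrushinDomain) (E : ℝ → DiscreteDobrushin), ZdDiscretisationFamily D E →
            ∀ f : BoundedContinuousFunction (CurveClass ℂ) ℝ,
              Tendsto (fun n => ∫ ω, f (bondInterfaceIn D (E (δs n)) ω) ∂(bondPercolation (zdGraph 2) half))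
                atTop (nhds (∫ γ, f γ ∂(P D))))

/-- (FL2, rev. 2) Exact boundary-touch exponent `1/3` at a locally FLAT boundary point: there are a Dobrushin domain
`D`, a point `z` of its second arc other than the marks, near which `D` is the open half-disc
`{w ∈ B(z, r) | Im(ū (w − z)) > 0}` (`u` the unit tangent direction of `∂D` at `z`), and constants with
`c ε^{1/3} ≤ P D {γ comes ε-close to z} ≤ C ε^{1/3}` for small `ε`. (For chordal SLE_κ at a smooth boundary point
the exponent is `8/κ − 1`; the prover of S3 chooses a diagonal wall, Ikhlef–Ponsaing's geometry.) -/
def TouchExponentOneThird (P : ChordalFamily) : Prop :=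
  (∃ (D : DobrushinDomain) (z u : ℂ) (r : ℝ), z ∈ D.arc 1 ∧ z ≠ D.pt 0 ∧ z ≠ D.pt 1 ∧ ‖u‖ = 1 ∧ 0 < r ∧
        D.carrier ∩ Metric.ball z r = {w | w ∈ Metric.ball z r ∧ 0 < ((starRingEnd ℂ) u * (w - z)).im} ∧
        ∃ c C ε₀ : ℝ, 0 < c ∧ 0 < ε₀ ∧ ∀ ε ∈ Set.Ioo 0 ε₀,
          c * ε ^ (1 / 3 : ℝ) ≤ (P D).real {γ | ∃ w ∈ γ.range, dist w z < ε} ∧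
            (P D).real {γ | ∃ w ∈ γ.range, dist w z < ε} ≤ C * ε ^ (1 / 3 : ℝ))

/-- Cardy's formula for `P` on conformal rectangles, in the form of the tree's SLE₆ fact `sle_six_measureReal_hitsBefore`. -/
def CardyOnRectangles (P : ChordalFamily) : Prop :=
  (∀ (R : ConformalRectangle) (φ : ConformalEquiv upperHalfPlaneSet R.carrier) (x : Fin 4 → ℝ),
        R.IsUniformizing φ x →
          (P (R.chord 0 2 (by decide))).real (CurveClass.hitsBefore (R.arc 2) (R.arc 1)) =
            cardyFunction (crossRatio x))

/-- The open middle of S5 (Schramm's principle output for the clause-(iv) family): in some uniformized Dobrushin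
domain `(D₀, φ)` the curve of `P D₀` is a Loewner chain driven by `W` with `W/√6` a continuous local martingale of
quadratic variation `t` (Werner 2007 Lemma 3.3 + §3.8; Schramm 2000 §1). -/
def MiddleDrivingMartingale (P : ChordalFamily) : Prop :=
  (∃ (D₀ : DobrushinDomain) (φ : ConformalEquiv upperHalfPlaneSet D₀.carrier) (W : CurveClass ℂ → NNReal → ℝ)
        (𝓕 : Filtration NNReal (inferInstance : MeasurableSpace (CurveClass ℂ))),
        D₀.IsChordalUniformizing φ ∧ IsProbabilityMeasure (P D₀) ∧ (∀ t, Measurable fun c => W c t) ∧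
        (∀ᵐ c ∂(P D₀), W c 0 = 0) ∧ (∀ᵐ c ∂(P D₀), Continuous (W c)) ∧
        IsLocalMartingale (fun t c => (Real.sqrt 6)⁻¹ * W c t) 𝓕 (P D₀) ∧
        Literature.Probability.Process.HasQuadraticVariation (fun t c => (Real.sqrt 6)⁻¹ * W c t) (fun t _ => (t : ℝ))
          𝓕 (P D₀) ∧
        ∀ᵐ c ∂(P D₀), Loewner.IsDrivenBy φ.boundaryExtension (D₀.pt 1) (W c) c)

/-! ### Open stubs (registered) -/

/-- Registered stub `stub_conformalFront` (S1 · THE FRONT END; open problem, held by the lead). A chordal family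
that is similarity covariant, domain Markov, local, target independent, a.s. traces no boundary arc, and is the
bond-ℤ² interface scaling limit along one mesh sequence on every admissibly discretised Dobrushin domain
(clause (iv)) is conformally covariant. No printed mechanism (Schramm 2000 §1, Werner 2007 §3.2 need conformal
covariance as input; the lattice side is Smirnov's ICM 2006 conjecture at `q = 1`; barrier
`ScaleCovarianceNotMoebius`: model input is needed — here clause (iv); wave 1 adds that reversibility (S2) and
achirality (S6) of such `P` are THEOREMS). Hypotheses: `IsLocalMarkovChordalFamily P`, `NonTracing P`, `ClauseIV P`. -/
theorem stub_conformalFront :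
    ∀ P : ChordalFamily, IsLocalMarkovChordalFamily P →
      (∀ D : DobrushinDomain, ∀ᵐ γ ∂(P D), ∀ c : Curve ℂ, CurveClass.mk c = γ →
        ∀ s t : unitInterval, s < t → c '' Set.Icc s t ⊆ frontier D.carrier →
          (c '' Set.Icc s t).Subsingleton) →
      ((∀ (D : DobrushinDomain) (E : ℝ → DiscreteDobrushin), ZdDiscretisationFamily D E →
          ∀ᶠ δ in nhdsWithin (0 : ℝ) (Set.Ioi 0),
            AEMeasurable (bondInterfaceIn D (E δ)) (bondPercolation (zdGraph 2) half)) ∧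
        ∃ δs : ℕ → ℝ, (∀ n, 0 < δs n) ∧ Tendsto δs atTop (nhds 0) ∧
          ∀ (D : DobrushinDomain) (E : ℝ → DiscreteDobrushin), ZdDiscretisationFamily D E →
            ∀ f : BoundedContinuousFunction (CurveClass ℂ) ℝ,
              Tendsto (fun n => ∫ ω, f (bondInterfaceIn D (E (δs n)) ω) ∂(bondPercolation (zdGraph 2) half))
                atTop (nhds (∫ γ, f γ ∂(P D)))) →
      P.IsConformallyCovariant := by
  sorry

/-- Registered stub `stub_pinnedSchrammLSW` (S7 · TYPED SCHRAMM–LSW FOR THE PINNED FAMILY; PRIMARY back end; open,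
crux-sized). A conformally covariant, isometry covariant, reversible, local, target-independent, domain-Markov chordal
family that a.s. traces no boundary arc and is the bond-ℤ² interface limit of clause (iv) is the chordal SLE₆ law in
every Dobrushin domain (Schramm 2000 §1 + Werner 2007 §3.2–3.8: conformal covariance + Markov ⇒ driving process
`√κ B`; target independence ⇒ `κ = 6`, landed `stub_localityPinsSix`; identification via `IsSLELaw`). Sufficient, all
landed or registered elsewhere: the predecessor's `stub_typedSchrammLSW` / `stub_typedSchrammPrincipleOne`
(stmt-CriticalPhenomena-0698, open; obstruction: `IsMarkovExtension.domain` renews only at JORDAN remaining sets), or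
`MiddleDrivingMartingale P` via `cardyPinsSLE6_of_drivingMartingale` (p134399). Hypotheses: `IsLocalMarkovChordalFamily P`,
`NonTracing P`, `ClauseIV P`, `P.IsConformallyCovariant`, `P.IsIsometryCovariant`, `P.IsReversible`. -/
theorem stub_pinnedSchrammLSW :
    ∀ P : ChordalFamily, IsLocalMarkovChordalFamily P →
      (∀ D : DobrushinDomain, ∀ᵐ γ ∂(P D), ∀ c : Curve ℂ, CurveClass.mk c = γ →
        ∀ s t : unitInterval, s < t → c '' Set.Icc s t ⊆ frontier D.carrier →
          (c '' Set.Icc s t).Subsingleton) →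
      ((∀ (D : DobrushinDomain) (E : ℝ → DiscreteDobrushin), ZdDiscretisationFamily D E →
          ∀ᶠ δ in nhdsWithin (0 : ℝ) (Set.Ioi 0),
            AEMeasurable (bondInterfaceIn D (E δ)) (bondPercolation (zdGraph 2) half)) ∧
        ∃ δs : ℕ → ℝ, (∀ n, 0 < δs n) ∧ Tendsto δs atTop (nhds 0) ∧
          ∀ (D : DobrushinDomain) (E : ℝ → DiscreteDobrushin), ZdDiscretisationFamily D E →
            ∀ f : BoundedContinuousFunction (CurveClass ℂ) ℝ,
              Tendsto (fun n => ∫ ω, f (bondInterfaceIn D (E (δs n)) ω) ∂(bondPercolation (zdGraph 2) half))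
                atTop (nhds (∫ γ, f γ ∂(P D)))) →
      P.IsConformallyCovariant → P.IsIsometryCovariant → P.IsReversible →
      ∀ D : DobrushinDomain, IsSLELaw 6 D (P D) := by
  sorry

/-- Former registered stub `stub_touchExponent` (S3 rev. 2 · FL2 at a flat wall). For the clause-(iv) family there is a
Dobrushin domain with a locally flat boundary point `z` on the second arc at which the touch probability is
`≍ ε^{1/3}` (two-sided constants). Intended proof: `D` a square with DIAGONAL sides (`polygonDomain`), `z` the midpoint
of a side of the dual-wired arc; lattice side = the diagonal half-plane one-arm probability between scales `ε/δ` and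
`1/δ`, `≍ ε^{1/3}` uniformly in `δ` from Ikhlef–Ponsaing Prop. 4.7 (`IkhlefPonsaingFirstPassage`; two-sided
`m^{-1/3}` bounds from the product recursion `stub_ipRecursion_of_ikhlefPonsaing`, sandwich
`stub_passageLeArm`/`stub_armLePassage` of Theorems/CardyBoundaryCoulombGasHalfPlaneOneArmThird*.lean) and
quasi-multiplicativity (`Literature/Probability/Percolation/HalfPlaneOneArmQuasiMultiplicativity.lean`); interface
near `z` ⟺ wired cluster near `z` (lattice topology) and RSW gluing in the square; limit by the landed
`stub_touchExponent_ofLatticeBounds` (p134318). Hypotheses: `IsLocalMarkovChordalFamily P`, `NonTracing P`,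
`ClauseIV P`; conclusion `TouchExponentOneThird P` (unfolded).

REVISION 4: no longer a stub — CLOSED MODULO the named fact `IkhlefPonsaingFirstPassage` by the landed
`Theorems.SymmetryUpgradeR.SwallowingSkeleton.touchExponent_of_ikhlefPonsaing` (p140621), whose statement is
`IkhlefPonsaingFirstPassage →` the registered S3 signature verbatim (flat DIAGONAL wall `z = −(1+i)/2` of the triangle
`(Δ; −1, −i)`, `Δ = {re < 0, im < 0, re + im > −1}`). -/
theorem touchExponent (hIP : Literature.Probability.Percolation.IkhlefPonsaingFirstPassage) (P : ChordalFamily)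
    (hP : IsLocalMarkovChordalFamily P) (hnt : NonTracing P) (hIV : ClauseIV P) : TouchExponentOneThird P :=
  Summit.CriticalPhenomena.CardyFormulaZ2.Theorems.SymmetryUpgradeR.SwallowingSkeleton.touchExponent_of_ikhlefPonsaing
    hIP P hP hnt hIV

/-- Registered stub `stub_ikhlefPonsaing` (S3′ · the NAMED LITERATURE FACT behind S3, verbatim). Ikhlef–Ponsaing,
J. Stat. Phys. 149 (2012) Prop. 4.7: the exact first-site passage probability of the homogeneous percolation strip,
`A_V(2m+1) A_V(2m+3) / N_8(2m+2)²`, in the tree's percolation dictionary (`Literature.Probability.Percolation.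
IkhlefPonsaingFirstPassage`, a `def … : Prop`, refereed, vendored unproved; numerically certified exactly for `m ≤ 4`
on stmt-CriticalPhenomena-11387; its proof is the paper's `q`KZ computation). It is a stub of this skeleton only so
that the pin composition's single unproved INPUT is a registered obligation; whoever formalises the fact closes it. -/
theorem stub_ikhlefPonsaing : Literature.Probability.Percolation.IkhlefPonsaingFirstPassage := by
  sorry

/-- Registered stub `stub_exitRigidity` (S4 rev. 2 · FL4, THE PIN; lattice-free; NEW mathematics). For a conformally
covariant, isometry covariant (achiral), reversible, local, target-independent, domain-Markov, non-tracing chordal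
family the hitting probability of a conformal rectangle is one function `F_P` of the cross-ratio (LANDED:
`exitRigidity_exitFunctionOfModulus_isometry`); locality (LSW hull trick) + renewal at boundary-arc landings
(`Negative.MarkovRenewal.kernel_eq_of_jordan_remaining`) tie the touch exponent at a flat boundary point to the
boundary asymptotics `F_P(η) ≍ η^{1/3}`; the claim is that among renewal-consistent exit functions this selects
Cardy's (oblique-RBM family `F_θ`, Lawler 2005 Props. 6.37–6.39 / Dubédat 2004; Kleban–Zagier as alternative pin).
Wave-1 audit: no counterexample on record (germ rules fail conformal covariance; retrace decorations fail typed Markov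
and are Cardy-exact; mixtures fail Markov). Hypotheses: `IsLocalMarkovChordalFamily P`, `NonTracing P`,
`P.IsConformallyCovariant`, `P.IsIsometryCovariant`, `P.IsReversible`, `TouchExponentOneThird P`; conclusion
`CardyOnRectangles P`. -/
theorem stub_exitRigidity :
    ∀ P : ChordalFamily, IsLocalMarkovChordalFamily P →
      (∀ D : DobrushinDomain, ∀ᵐ γ ∂(P D), ∀ c : Curve ℂ, CurveClass.mk c = γ →
        ∀ s t : unitInterval, s < t → c '' Set.Icc s t ⊆ frontier D.carrier →
          (c '' Set.Icc s t).Subsingleton) →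
      P.IsConformallyCovariant → P.IsIsometryCovariant → P.IsReversible →
      (∃ (D : DobrushinDomain) (z u : ℂ) (r : ℝ), z ∈ D.arc 1 ∧ z ≠ D.pt 0 ∧ z ≠ D.pt 1 ∧ ‖u‖ = 1 ∧ 0 < r ∧
        D.carrier ∩ Metric.ball z r = {w | w ∈ Metric.ball z r ∧ 0 < ((starRingEnd ℂ) u * (w - z)).im} ∧
        ∃ c C ε₀ : ℝ, 0 < c ∧ 0 < ε₀ ∧ ∀ ε ∈ Set.Ioo 0 ε₀,
          c * ε ^ (1 / 3 : ℝ) ≤ (P D).real {γ | ∃ w ∈ γ.range, dist w z < ε} ∧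
            (P D).real {γ | ∃ w ∈ γ.range, dist w z < ε} ≤ C * ε ^ (1 / 3 : ℝ)) →
      (∀ (R : ConformalRectangle) (φ : ConformalEquiv upperHalfPlaneSet R.carrier) (x : Fin 4 → ℝ),
        R.IsUniformizing φ x →
          (P (R.chord 0 2 (by decide))).real (CurveClass.hitsBefore (R.arc 2) (R.arc 1)) =
            cardyFunction (crossRatio x)) := by
  sorry

/-- Registered stub `stub_middleDrivingMartingale` (S5a · SCHRAMM'S PRINCIPLE FOR THE CLAUSE-(iv) FAMILY; open). For
the percolation limit family with conformal covariance, achirality, reversibility and Cardy's hitting function on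
all conformal rectangles, the driving process of `P D₀` in some uniformized domain is `√6 ×` a continuous local
martingale with quadratic variation `t` (Werner 2007 Lemma 3.3: conformal covariance + domain Markov ⇒ stationary
independent increments + Brownian scaling; §3.8 / LSW 2001 §3: Cardy ⇒ `κ = 6`). Typed obstruction recorded by the
predecessor crux (Cruxes/CardyRotToConfR2SymmetryUpgrade/NOTES.md §4): `IsMarkovExtension.domain` pins the kernel only
at JORDAN remaining domains, so the increments step must come from boundary-arc renewals or from clause (iv) (the
discrete exploration IS Markov in slit domains) — `= stub_typedSchrammPrincipleOne` of that crux applied to `P`,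
weakened by four extra hypotheses. Hypotheses: the seven of the former S5; conclusion `MiddleDrivingMartingale P`. -/
theorem stub_middleDrivingMartingale :
    ∀ P : ChordalFamily, IsLocalMarkovChordalFamily P →
      (∀ D : DobrushinDomain, ∀ᵐ γ ∂(P D), ∀ c : Curve ℂ, CurveClass.mk c = γ →
        ∀ s t : unitInterval, s < t → c '' Set.Icc s t ⊆ frontier D.carrier →
          (c '' Set.Icc s t).Subsingleton) →
      ((∀ (D : DobrushinDomain) (E : ℝ → DiscreteDobrushin), ZdDiscretisationFamily D E →
          ∀ᶠ δ in nhdsWithin (0 : ℝ) (Set.Ioi 0),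
            AEMeasurable (bondInterfaceIn D (E δ)) (bondPercolation (zdGraph 2) half)) ∧
        ∃ δs : ℕ → ℝ, (∀ n, 0 < δs n) ∧ Tendsto δs atTop (nhds 0) ∧
          ∀ (D : DobrushinDomain) (E : ℝ → DiscreteDobrushin), ZdDiscretisationFamily D E →
            ∀ f : BoundedContinuousFunction (CurveClass ℂ) ℝ,
              Tendsto (fun n => ∫ ω, f (bondInterfaceIn D (E (δs n)) ω) ∂(bondPercolation (zdGraph 2) half))
                atTop (nhds (∫ γ, f γ ∂(P D)))) →
      P.IsConformallyCovariant → P.IsIsometryCovariant → P.IsReversible →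
      (∀ (R : ConformalRectangle) (φ : ConformalEquiv upperHalfPlaneSet R.carrier) (x : Fin 4 → ℝ),
        R.IsUniformizing φ x →
          (P (R.chord 0 2 (by decide))).real (CurveClass.hitsBefore (R.arc 2) (R.arc 1)) =
            cardyFunction (crossRatio x)) →
      (∃ (D₀ : DobrushinDomain) (φ : ConformalEquiv upperHalfPlaneSet D₀.carrier) (W : CurveClass ℂ → NNReal → ℝ)
        (𝓕 : Filtration NNReal (inferInstance : MeasurableSpace (CurveClass ℂ))),
        D₀.IsChordalUniformizing φ ∧ IsProbabilityMeasure (P D₀) ∧ (∀ t, Measurable fun c => W c t) ∧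
        (∀ᵐ c ∂(P D₀), W c 0 = 0) ∧ (∀ᵐ c ∂(P D₀), Continuous (W c)) ∧
        IsLocalMartingale (fun t c => (Real.sqrt 6)⁻¹ * W c t) 𝓕 (P D₀) ∧
        Literature.Probability.Process.HasQuadraticVariation (fun t c => (Real.sqrt 6)⁻¹ * W c t) (fun t _ => (t : ℝ))
          𝓕 (P D₀) ∧
        ∀ᵐ c ∂(P D₀), Loewner.IsDrivenBy φ.boundaryExtension (D₀.pt 1) (W c) c) := by
  sorry

/-! ### Closed pieces (landed theorems) -/

/-- S2, CLOSED (p134454): reversibility of the clause-(iv) family —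
`Theorems.SymmetryUpgradeR.SwallowingSkeleton.stub_reversible`. -/
theorem reversible (P : ChordalFamily) (hP : IsLocalMarkovChordalFamily P) (hnt : NonTracing P)
    (hIV : ClauseIV P) : P.IsReversible :=
  Summit.CriticalPhenomena.CardyFormulaZ2.Theorems.SymmetryUpgradeR.SwallowingSkeleton.stub_reversible P hP hnt hIV

/-- S6, CLOSED (p135156): achirality of the clause-(iv) family —
`Theorems.SymmetryUpgradeR.SwallowingSkeleton.stub_reflectionCovariant`. -/
theorem reflectionCovariant (P : ChordalFamily) (hP : IsLocalMarkovChordalFamily P) (hnt : NonTracing P)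
    (hIV : ClauseIV P) : P.IsIsometryCovariant :=
  Summit.CriticalPhenomena.CardyFormulaZ2.Theorems.SymmetryUpgradeR.SwallowingSkeleton.stub_reflectionCovariant
    P hP hnt hIV

/-- S5 as registered in revision 1 (Cardy on rectangles + … ⇒ SLE₆), now a THEOREM of the open middle S5a and the
landed `cardyPinsSLE6_of_drivingMartingale` (p134399). -/
theorem cardyPinsSLE6 (P : ChordalFamily) (hP : IsLocalMarkovChordalFamily P) (hnt : NonTracing P)
    (hIV : ClauseIV P) (hcov : P.IsConformallyCovariant) (hiso : P.IsIsometryCovariant) (hrev : P.IsReversible)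
    (hcardy : CardyOnRectangles P) : ∀ D : DobrushinDomain, IsSLELaw 6 D (P D) :=
  Summit.CriticalPhenomena.CardyFormulaZ2.Theorems.SymmetryUpgradeR.SwallowingSkeleton.cardyPinsSLE6_of_drivingMartingale
    P hcov (stub_middleDrivingMartingale P hP hnt hIV hcov hiso hrev hcardy)

/-! ### The skeleton theorems -/

/-- THE SKELETON THEOREM (PRIMARY, revision 3): the crux BY NAME from S1 `stub_conformalFront` and S7
`stub_pinnedSchrammLSW` (sorries only there; S2, S6 are landed theorems). -/
theorem SymmetryUpgradeR_of :
    Summit.CriticalPhenomena.CardyFormulaZ2.Theses.CardySelfRefinement.SymmetryUpgradeR := by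
  intro P hP hnt hmeas hconv D _E _hE
  have hIV : ClauseIV P := ⟨hmeas, hconv⟩
  exact stub_pinnedSchrammLSW P hP hnt hIV (stub_conformalFront P hP hnt hIV) (reflectionCovariant P hP hnt hIV)
    (reversible P hP hnt hIV) D

/-- ALTERNATIVE SKELETON (the card's pin route, revision 4): the crux BY NAME from S1 `stub_conformalFront`, S4
`stub_exitRigidity`, S5a `stub_middleDrivingMartingale`, CONDITIONALLY on the named Literature fact
`IkhlefPonsaingFirstPassage` (registered as S3′ `stub_ikhlefPonsaing`) through the closed S3 `touchExponent` (S2, S6,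
S3-modulo-fact and the S5 glue landed). -/
theorem SymmetryUpgradeR_of_pin :
    Summit.CriticalPhenomena.CardyFormulaZ2.Theses.CardySelfRefinement.SymmetryUpgradeR := by
  intro P hP hnt hmeas hconv D _E _hE
  have hIP : Literature.Probability.Percolation.IkhlefPonsaingFirstPassage := stub_ikhlefPonsaing
  have hIV : ClauseIV P := ⟨hmeas, hconv⟩
  have hiso : P.IsIsometryCovariant := reflectionCovariant P hP hnt hIV
  have hrev : P.IsReversible := reversible P hP hnt hIV
  have htouch : TouchExponentOneThird P := touchExponent hIP P hP hnt hIV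
  have hcov : P.IsConformallyCovariant := stub_conformalFront P hP hnt hIV
  have hcardy : CardyOnRectangles P := stub_exitRigidity P hP hnt hcov hiso hrev htouch
  exact cardyPinsSLE6 P hP hnt hIV hcov hiso hrev hcardy D

end Summit.CriticalPhenomena.CardyFormulaZ2.Cruxes.SymmetryUpgradeR.SwallowingSkeleton

end
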